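import Literature.AlgebraicGeometry.Morphisms.CompactificationExtension
import Literature.AlgebraicGeometry.Morphisms.SeparatedGluing
import Literature.AlgebraicGeometry.Limits.PushoutOpenImmersion
import HarnessLib

/-!
# The pieces `Wᵢ = U ⨿_{Uᵢ} (Xᵢ ∖ Z̄ᵢⱼ)` of the two-piece compactification (Stacks 0F40)

Topic: `Literature/AlgebraicGeometry/Morphisms`. Bookkeeping for the two-piece induction step
(The Stacks Project, Tag 0F40 = More on Flatness, Lemma 38.33.7) of the proof of Nagata's
compactification theorem (Tag 0F41; the named fact
`Literature.AlgebraicGeometry.Morphisms.NagataCompactification`). Given `g : U → S` separated of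
finite type and an open `Uᵢ ⊆ U`:

* `ExtData g Uᵢ` — the data "a compactification `Xᵢ` of `Uᵢ` over `S` together with an open
  `Vᵢ ⊆ Xᵢ` and a proper morphism `ψᵢ : Vᵢ → U` extending `Uᵢ → U`" of the printed proof
  ("We may assume there is an open `Vᵢ ⊂ Xᵢ` and a proper morphism `ψᵢ : Vᵢ → U` extending
  `id : Uᵢ → Uᵢ`, see Lemma 0F3Z"), with `ψᵢ` an isomorphism over `Uᵢ`;
  `ExtData.nonempty_of_compactification` — it exists as soon as `Uᵢ` is compactifiable
  (Tag 0F3Z, `stacks0F3Z_of_stacks081R`, conditional on `Stacks081R`);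
  `ExtData.blowup` — it is preserved by `Vᵢ`-admissible blowing ups of `Xᵢ` ("Observe that this
  property is preserved if we replace `Xᵢ` by a further `Vᵢ`-admissible blowup");
* `ExtData.locus Z = Vᵢ.ι(ψᵢ⁻¹ Z)` — the sets `Zᵢ,ᵢ = ψᵢ⁻¹(Zᵢ)`, `Zᵢ,ⱼ = ψᵢ⁻¹(Zⱼ)` of the printed
  proof, and their behaviour;
* `ExtData.piece` — the glued scheme `Wᵢ = U ⨿_{Uᵢ} Xᵢ°`, `Xᵢ° = Xᵢ ∖ Z̄ᵢⱼ` with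
  `Zᵢⱼ = ψᵢ⁻¹(U ∖ Uᵢ)`, its structure morphism `Wᵢ → S` (`pieceDesc`), locally of finite type,
  and **separated** (`isSeparated_pieceDesc`): by Tag 0F3U (`isSeparated_pushoutDesc`) it
  suffices that the graph `Uᵢ → U ×_S Xᵢ°` have closed image; the printed proof shows this by
  lifting specialisations along the proper `ψᵢ`; we instead observe that this image is the trace
  on the open `U ×_S Xᵢ°` of the image of `(ψᵢ, Vᵢ ↪ Xᵢ) : Vᵢ → U ×_S Xᵢ`, which is closed
  because that morphism is universally closed (`ψᵢ` is proper and `U ×_S Xᵢ → U` separated), a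
  point `(ψᵢ v, v)` with `v ∈ Xᵢ°` having `ψᵢ v ∈ Uᵢ` (else `v ∈ Zᵢⱼ`) and then `v = Uᵢ ↪ Vᵢ` of it.

Everything is proved; the only undischarged input is `Stacks081R`, in
`ExtData.nonempty_of_compactification`.

## References

* The Stacks Project, Tag 0F40 (Lemma 38.33.7), proof; Tags 0F3Z, 0F3U. [StacksProject]
-/

noncomputable section

-- Mathlib's pull-back API is stated through `abbrev`s over `limit`; as in Mathlib's own
-- algebraic-geometry files we let `simp`/unification see through them.
set_option backward.isDefEq.respectTransparency false

universe u

open CategoryTheory CategoryTheory.Limits AlgebraicGeometry TopologicalSpace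
open Literature.AlgebraicGeometry.Resolution

namespace Literature.AlgebraicGeometry.Morphisms

/-! ## The extension data -/

/-- **A compactification of `Uᵢ` over `S` with a proper extension of `Uᵢ → U` to an open**
(the situation after Tag 0F3Z in the proof of Tag 0F40): `jX : Uᵢ → X` an open immersion into a
proper `S`-scheme `πX : X → S`, an open `V ⊆ X`, a proper `ψ : V → U` over `S`, and
`sV : Uᵢ → V` with `sV ≫ (V ↪ X) = jX`, `sV ≫ ψ = (Uᵢ ↪ U)`, and `ψ` an isomorphism over `Uᵢ`.
[cite: StacksProject, Tag 0F40 (proof)] -/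
structure ExtData {U S : Scheme.{u}} (g : U ⟶ S) (Ui : U.Opens) where
  /-- the compactification of `Uᵢ` -/
  (X : Scheme.{u})
  /-- the open immersion `Uᵢ → X` -/
  (jX : (Ui : Scheme.{u}) ⟶ X)
  /-- the proper structure morphism -/
  (πX : X ⟶ S)
  /-- the open on which `Uᵢ → U` extends -/
  (V : X.Opens)
  /-- the proper extension -/
  (ψ : (V : Scheme.{u}) ⟶ U)
  /-- `Uᵢ → V` -/
  (sV : (Ui : Scheme.{u}) ⟶ V)
  [isOpenImmersion_jX : IsOpenImmersion jX]
  [isProper_πX : IsProper πX]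
  [isProper_ψ : IsProper ψ]
  jX_πX : jX ≫ πX = Ui.ι ≫ g
  sV_ι : sV ≫ V.ι = jX
  sV_ψ : sV ≫ ψ = Ui.ι
  ψ_g : ψ ≫ g = V.ι ≫ πX
  isIso_ψ : IsIso (ψ ∣_ Ui)

namespace ExtData

variable {U S : Scheme.{u}} {g : U ⟶ S} {Ui : U.Opens}

attribute [instance] isOpenImmersion_jX isProper_πX isProper_ψ

/-- **Existence (Tag 0F3Z, conditional on `Stacks081R`)**: if `Uᵢ` is quasi-compact and
compactifiable over `S` (with `g` separated of finite type, `S` quasi-compact and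
quasi-separated), the extension data exists. [cite: StacksProject, Tag 0F40 (proof)] -/
theorem nonempty_of_compactification (hRG : Stacks081R.{u}) [CompactSpace S] [QuasiSeparatedSpace S]
    (g : U ⟶ S) [IsSeparated g] [LocallyOfFiniteType g] [QuasiCompact g] (Ui : U.Opens)
    (hUi : IsCompact (Ui : Set U))
    (h : ∃ (Y : Scheme.{u}) (j : (Ui : Scheme.{u}) ⟶ Y) (π : Y ⟶ S),
      IsOpenImmersion j ∧ IsProper π ∧ j ≫ π = Ui.ι ≫ g) :
    Nonempty (ExtData g Ui) := by
  obtain ⟨Y, j, π, hj, hπ, hcomm⟩ := h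
  haveI := hj
  haveI := hπ
  haveI : QuasiSeparatedSpace U := quasiSeparatedSpace_of_quasiSeparated g
  haveI : QuasiCompact Ui.ι := Limits.quasiCompact_ι_of_isCompact Ui hUi
  obtain ⟨Y', jY', πY', V', ψ, sV, hjY', hπY', hcomm', hψ, hsV, hsVψ, hψg, hiso⟩ :=
    stacks0F3Z_of_stacks081R hRG g Ui.ι j π hcomm
  haveI := hjY'
  haveI := hπY'
  haveI := hψ
  rw [Scheme.Opens.opensRange_ι] at hiso
  exact ⟨ExtData.mk (X := Y') (jX := jY') (πX := πY') (V := V') (ψ := ψ) (sV := sV) hcomm' hsV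
    hsVψ hψg hiso⟩

variable (E : ExtData g Ui)

/-- `sV : Uᵢ → V` is an open immersion. [folklore] -/
instance isOpenImmersion_sV : IsOpenImmersion E.sV := by
  have h : IsOpenImmersion (E.sV ≫ E.V.ι) := by rw [E.sV_ι]; infer_instance
  exact .of_comp _ E.V.ι

/-- The inverse of `ψ|_{Uᵢ}` is the corestriction of `sV`: `sV` followed by `ψ` is `Uᵢ ↪ U`, so
a point of `V` over `Uᵢ` is `sV` of its image. [folklore] -/
theorem eq_sV_of_mem (v : E.V) (hv : E.ψ v ∈ Ui) : v = E.sV ⟨E.ψ v, hv⟩ := by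
  haveI := E.isIso_ψ
  -- the corestriction `s' : Uᵢ → ψ⁻¹(Uᵢ)` of `sV` is a section of the isomorphism `ψ|_{Uᵢ}`
  have hrange : Set.range E.sV ⊆ Set.range (E.ψ ⁻¹ᵁ Ui).ι := by
    rw [Scheme.Opens.range_ι]
    rintro _ ⟨x, rfl⟩
    show E.ψ (E.sV x) ∈ Ui
    rw [← Scheme.Hom.comp_apply, E.sV_ψ]
    exact x.2
  set s' := IsOpenImmersion.lift (E.ψ ⁻¹ᵁ Ui).ι E.sV hrange with hs'
  have hs'ι : s' ≫ (E.ψ ⁻¹ᵁ Ui).ι = E.sV := IsOpenImmersion.lift_fac _ _ _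
  have hsec : s' ≫ (E.ψ ∣_ Ui) = 𝟙 _ := by
    rw [← cancel_mono Ui.ι, Category.assoc, morphismRestrict_ι, ← Category.assoc, hs'ι, E.sV_ψ,
      Category.id_comp]
  have hinv : s' = inv (E.ψ ∣_ Ui) := by
    rw [← Category.comp_id s', ← IsIso.hom_inv_id (E.ψ ∣_ Ui), ← Category.assoc, hsec, Category.id_comp]
  -- apply to the point `w = v ∈ ψ⁻¹(Uᵢ)`
  set w : ↥(E.ψ ⁻¹ᵁ Ui) := ⟨v, hv⟩ with hw
  have hpt : (E.ψ ∣_ Ui) w = ⟨E.ψ v, hv⟩ := Subtype.ext (morphismRestrict_base_coe E.ψ Ui w)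
  have h2 : s' ((E.ψ ∣_ Ui) w) = w := by
    rw [← Scheme.Hom.comp_apply, hinv, IsIso.hom_inv_id]; rfl
  calc v = (E.ψ ⁻¹ᵁ Ui).ι w := rfl
    _ = (E.ψ ⁻¹ᵁ Ui).ι (s' ((E.ψ ∣_ Ui) w)) := by rw [h2]
    _ = E.sV ((E.ψ ∣_ Ui) w) := by rw [← Scheme.Hom.comp_apply, hs'ι]
    _ = E.sV ⟨E.ψ v, hv⟩ := by rw [hpt]

/-! ### The loci `ψ⁻¹(Z) ⊆ V ⊆ X` -/

/-- The set `Vᵢ.ι(ψᵢ⁻¹ Z) ⊆ Xᵢ` for `Z ⊆ U` (in the printed proof: `Zᵢ,ᵢ = ψᵢ⁻¹(Zᵢ)`,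
`Zᵢ,ⱼ = ψᵢ⁻¹(Zⱼ)`). [cite: StacksProject, Tag 0F40 (proof)] -/
def locus (Z : Set U) : Set E.X := E.V.ι '' (E.ψ ⁻¹' Z)

/-- The locus lies in `V`. [folklore] -/
theorem locus_subset (Z : Set U) : E.locus Z ⊆ (E.V : Set E.X) := by
  rintro _ ⟨v, -, rfl⟩
  exact v.2

/-- A point of `V` lies in the locus of `Z` iff `ψ` maps it into `Z`. [folklore] -/
theorem mem_locus_iff (Z : Set U) (v : E.V) : E.V.ι v ∈ E.locus Z ↔ E.ψ v ∈ Z := by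
  constructor
  · rintro ⟨v', hv', h⟩
    rw [E.V.ι.injective h] at hv'
    exact hv'
  · exact fun h => ⟨v, h, rfl⟩

/-- The locus of a complement is the complement in `V`. [folklore] -/
theorem locus_compl (Z : Set U) : E.locus Zᶜ = (E.V : Set E.X) \ E.locus Z := by
  ext x
  constructor
  · rintro ⟨v, hv, rfl⟩
    exact ⟨v.2, fun h => hv ((E.mem_locus_iff Z v).mp h)⟩
  · rintro ⟨hxV, hx⟩
    refine ⟨⟨x, hxV⟩, fun h => hx ?_, rfl⟩
    exact (E.mem_locus_iff Z ⟨x, hxV⟩).mpr h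

/-- The locus of an open set is open. [folklore] -/
theorem isOpen_locus {O : Set U} (hO : IsOpen O) : IsOpen (E.locus O) :=
  E.V.ι.isOpenEmbedding.isOpenMap _ (hO.preimage E.ψ.continuous)

/-- The locus of a quasi-compact open is quasi-compact (`ψ` is quasi-compact). [folklore] -/
theorem isCompact_locus (O : U.Opens) (hO : IsCompact (O : Set U)) : IsCompact (E.locus O) :=
  (E.ψ.isCompact_preimage hO).image E.V.ι.continuous

/-- For `Z` closed, `ψ⁻¹(Z)` is closed in `V`: the closure of the locus meets `V` only in the
locus. [folklore] -/
theorem closure_locus_inter (Z : Set U) (hZ : IsClosed Z) :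
    closure (E.locus Z) ∩ (E.V : Set E.X) ⊆ E.locus Z := by
  rintro x ⟨hx, hxV⟩
  -- pull back along the open embedding `V ↪ X`
  have h1 : (⟨x, hxV⟩ : E.V) ∈ closure (E.V.ι ⁻¹' E.locus Z) := by
    rw [E.V.ι.isOpenEmbedding.isInducing.closure_eq_preimage_closure_image,
      Set.image_preimage_eq_inter_range, Scheme.Opens.range_ι,
      Set.inter_eq_left.mpr (E.locus_subset Z)]
    exact hx
  have h2 : E.V.ι ⁻¹' E.locus Z = E.ψ ⁻¹' Z := by
    ext v; exact E.mem_locus_iff Z v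
  rw [h2, (hZ.preimage E.ψ.continuous).closure_eq] at h1
  exact ⟨_, h1, rfl⟩

/-- `Uᵢ` does not meet the locus of `U ∖ Uᵢ`. [folklore] -/
theorem jX_not_mem_locus_compl (x : Ui) : E.jX x ∉ E.locus (Ui : Set U)ᶜ := by
  intro h
  rw [← E.sV_ι, Scheme.Hom.comp_apply, E.mem_locus_iff] at h
  apply h
  show E.ψ (E.sV x) ∈ Ui
  rw [← Scheme.Hom.comp_apply, E.sV_ψ]
  exact x.2

/-! ### Transport along a `V`-admissible blowing up -/

section Blowup

variable {X' : Scheme.{u}} (β : X' ⟶ E.X) {C : E.X.IdealSheafData} (hβ : IsBlowup β C)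
  (hCfg : ∀ W : E.X.affineOpens, (C.ideal W).FG) (hCV : Disjoint ((E.V : Set E.X)) (C.support : Set E.X))

include hβ hCV in
/-- A `V`-admissible blowing up is an isomorphism over `V`. [folklore] -/
theorem isIso_restrict_of_blowup : IsIso (β ∣_ E.V) := hβ.isIso_morphismRestrict hCV

/-- **The extension data after a `Vᵢ`-admissible blowing up `β : X' → Xᵢ`**: `V' = β⁻¹Vᵢ ≅ Vᵢ`,
`ψ' = (β|_{Vᵢ}) ≫ ψᵢ`, `Uᵢ → V'` through the inverse of `β|_{Vᵢ}`. [cite: StacksProject, Tag 0F40 (proof)] -/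
def blowup : ExtData g Ui :=
  haveI := E.isIso_restrict_of_blowup β hβ hCV
  haveI : IsProper β := IsBlowup.isProper_of_fg hCfg hβ
  { X := X'
    jX := (E.sV ≫ inv (β ∣_ E.V)) ≫ (β ⁻¹ᵁ E.V).ι
    πX := β ≫ E.πX
    V := β ⁻¹ᵁ E.V
    ψ := (β ∣_ E.V) ≫ E.ψ
    sV := E.sV ≫ inv (β ∣_ E.V)
    jX_πX := by
      rw [Category.assoc, Category.assoc, ← morphismRestrict_ι_assoc, IsIso.inv_hom_id_assoc,
        ← Category.assoc, E.sV_ι, E.jX_πX]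
    sV_ι := rfl
    sV_ψ := by rw [Category.assoc, IsIso.inv_hom_id_assoc, E.sV_ψ]
    ψ_g := by rw [Category.assoc, E.ψ_g, ← Category.assoc, morphismRestrict_ι, Category.assoc]
    isIso_ψ := by
      haveI : IsIso ((β ∣_ E.V) ∣_ E.ψ ⁻¹ᵁ Ui) :=
        (MorphismProperty.isomorphisms.iff _).mp
          (IsZariskiLocalAtTarget.restrict ((MorphismProperty.isomorphisms.iff _).mpr inferInstance) _)
      haveI := E.isIso_ψ
      exact isIso_morphismRestrict_comp (β ∣_ E.V) E.ψ Ui }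

/-- The scheme after blowing up. [folklore] -/
@[simp] theorem blowup_X : (E.blowup β hβ hCfg hCV).X = X' := rfl

/-- The structure morphism after blowing up. [folklore] -/
@[simp] theorem blowup_πX : (E.blowup β hβ hCfg hCV).πX = β ≫ E.πX := rfl

/-- The open after blowing up is the preimage. [folklore] -/
@[simp] theorem blowup_V : (E.blowup β hβ hCfg hCV).V = β ⁻¹ᵁ E.V := rfl

/-- The extension after blowing up. [folklore] -/
@[simp] theorem blowup_ψ : (E.blowup β hβ hCfg hCV).ψ = (β ∣_ E.V) ≫ E.ψ := rfl

/-- The new open immersion of `Uᵢ` lifts the old one. [folklore] -/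
theorem blowup_jX_comp : (E.blowup β hβ hCfg hCV).jX ≫ β = E.jX := by
  haveI := E.isIso_restrict_of_blowup β hβ hCV
  show ((E.sV ≫ inv (β ∣_ E.V)) ≫ (β ⁻¹ᵁ E.V).ι) ≫ β = E.jX
  rw [Category.assoc, ← morphismRestrict_ι, Category.assoc, IsIso.inv_hom_id_assoc, E.sV_ι]

/-- The loci transform by preimage. [cite: StacksProject, Tag 0F40 (proof)] -/
theorem blowup_locus (Z : Set U) : (E.blowup β hβ hCfg hCV).locus Z = β ⁻¹' E.locus Z := by
  haveI := E.isIso_restrict_of_blowup β hβ hCV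
  ext x
  constructor
  · rintro ⟨v, hv, rfl⟩
    refine ⟨(β ∣_ E.V) v, hv, ?_⟩
    show E.V.ι ((β ∣_ E.V) v) = β ((β ⁻¹ᵁ E.V).ι v)
    rw [← Scheme.Hom.comp_apply, ← Scheme.Hom.comp_apply, morphismRestrict_ι]
  · rintro ⟨v, hv, h⟩
    have hxV : x ∈ β ⁻¹ᵁ E.V := by
      show β x ∈ E.V
      rw [← h]; exact v.2
    refine ⟨⟨x, hxV⟩, ?_, rfl⟩
    show E.ψ ((β ∣_ E.V) ⟨x, hxV⟩) ∈ Z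
    have : (β ∣_ E.V) ⟨x, hxV⟩ = v := by
      apply Subtype.ext
      rw [morphismRestrict_base_coe]
      exact h.symm
    rw [this]
    exact hv

end Blowup

/-! ### The piece `W = U ⨿_{Uᵢ} X°`, `X° = X ∖ closure (ψ⁻¹(U ∖ Uᵢ))` -/

/-- The open `X° = X ∖ Z̄ᵢⱼ`, `Zᵢⱼ = ψᵢ⁻¹(U ∖ Uᵢ)`. [cite: StacksProject, Tag 0F40 (proof)] -/
def core : E.X.Opens :=
  ⟨(closure (E.locus (Ui : Set U)ᶜ))ᶜ, isClosed_closure.isOpen_compl⟩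

/-- Membership in `X°`. [folklore] -/
theorem mem_core_iff (x : E.X) : x ∈ E.core ↔ x ∉ closure (E.locus (Ui : Set U)ᶜ) := Iff.rfl

/-- `Uᵢ` lands in `X°` (its closure-avoiding: `Z̄ᵢⱼ ∩ V = Zᵢⱼ` misses `Uᵢ`). [cite: StacksProject, Tag 0F40 (proof)] -/
theorem range_jX_subset_core : Set.range E.jX ⊆ (E.core : Set E.X) := by
  rintro _ ⟨x, rfl⟩ h
  have hV : E.jX x ∈ (E.V : Set E.X) := by
    rw [← E.sV_ι, Scheme.Hom.comp_apply]; exact (E.sV x).2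
  exact E.jX_not_mem_locus_compl x (E.closure_locus_inter _ Ui.2.isClosed_compl ⟨h, hV⟩)

/-- `Uᵢ → X°`. [cite: StacksProject, Tag 0F40 (proof)] -/
def jCore : (Ui : Scheme.{u}) ⟶ E.core :=
  IsOpenImmersion.lift E.core.ι E.jX (by rw [Scheme.Opens.range_ι]; exact E.range_jX_subset_core)

/-- `Uᵢ → X° ↪ X` is `jX`. [folklore] -/
@[reassoc (attr := simp)]
theorem jCore_ι : E.jCore ≫ E.core.ι = E.jX := IsOpenImmersion.lift_fac _ _ _

/-- `Uᵢ → X°` is an open immersion. [folklore] -/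
instance isOpenImmersion_jCore : IsOpenImmersion E.jCore := by
  have h : IsOpenImmersion (E.jCore ≫ E.core.ι) := by rw [E.jCore_ι]; infer_instance
  exact .of_comp _ E.core.ι

/-- **The piece `Wᵢ = U ⨿_{Uᵢ} Xᵢ°`** (push-out along the open immersions `Uᵢ ↪ U`, `Uᵢ → Xᵢ°`).
[cite: StacksProject, Tag 0F40 (proof)] -/
def piece : Scheme.{u} := pushout Ui.ι E.jCore

/-- The structure morphism `Wᵢ → S`. [cite: StacksProject, Tag 0F40 (proof)] -/
def pieceDesc : E.piece ⟶ S :=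
  pushout.desc g (E.core.ι ≫ E.πX) (by rw [jCore_ι_assoc, E.jX_πX])

/-- `U → Wᵢ → S` is `g`. [folklore] -/
@[reassoc (attr := simp)]
theorem inl_pieceDesc : pushout.inl Ui.ι E.jCore ≫ E.pieceDesc = g := pushout.inl_desc _ _ _

/-- `X° → Wᵢ → S` is `X° ↪ X → S`. [folklore] -/
@[reassoc (attr := simp)]
theorem inr_pieceDesc : pushout.inr Ui.ι E.jCore ≫ E.pieceDesc = E.core.ι ≫ E.πX := pushout.inr_desc _ _ _

/-- `U → Wᵢ` is an open immersion. [folklore] -/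
instance isOpenImmersion_inl : IsOpenImmersion (pushout.inl Ui.ι E.jCore) := Limits.isOpenImmersion_inl _ _
/-- `X° → Wᵢ` is an open immersion. [folklore] -/
instance isOpenImmersion_inr : IsOpenImmersion (pushout.inr Ui.ι E.jCore) := Limits.isOpenImmersion_inr _ _

/-- `Wᵢ → S` is locally of finite type. [folklore] -/
instance locallyOfFiniteType_pieceDesc [LocallyOfFiniteType g] : LocallyOfFiniteType E.pieceDesc :=
  Limits.locallyOfFiniteType_pushoutDesc _ _ _ _ _

/-- **`Wᵢ → S` is separated** (Tag 0F3U): the graph `Uᵢ → U ×_S Xᵢ°` has closed image, the trace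
of the closed image of `(ψᵢ, Vᵢ ↪ Xᵢ) : Vᵢ → U ×_S Xᵢ`. [cite: StacksProject, Tag 0F40 (proof)] -/
instance isSeparated_pieceDesc [IsSeparated g] : IsSeparated E.pieceDesc := by
  have w : Ui.ι ≫ g = E.jCore ≫ E.core.ι ≫ E.πX := by rw [jCore_ι_assoc, E.jX_πX]
  refine isSeparated_pushoutDesc Ui.ι E.jCore g (E.core.ι ≫ E.πX) w ?_
  -- the full graph `Γfull = (ψ, V ↪ X) : V → U ×_S X`, universally closed
  set Γfull : (E.V : Scheme.{u}) ⟶ pullback g E.πX := pullback.lift E.ψ E.V.ι E.ψ_g with hΓfull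
  haveI : UniversallyClosed (Γfull ≫ pullback.fst g E.πX) := by
    rw [hΓfull, pullback.lift_fst]; infer_instance
  haveI : UniversallyClosed Γfull := .of_comp_of_isSeparated Γfull (pullback.fst g E.πX)
  -- the open immersion `m : U ×_S X° → U ×_S X`
  set m : pullback g (E.core.ι ≫ E.πX) ⟶ pullback g E.πX :=
    pullback.map g (E.core.ι ≫ E.πX) g E.πX (𝟙 U) E.core.ι (𝟙 S) (by rw [Category.comp_id, Category.id_comp])
      (by rw [Category.comp_id]) with hm
  haveI : IsOpenImmersion m := by
    have := MorphismProperty.pullbackMap (P := @IsOpenImmersion) (f := g) (g := E.core.ι ≫ E.πX) (f' := g)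
      (g' := E.πX) (i₁ := 𝟙 U) (i₂ := E.core.ι) inferInstance inferInstance (Category.id_comp _).symm rfl
    exact this
  -- the graph factors: `Γ ≫ m = sV ≫ Γfull`
  set Γ := pullback.lift Ui.ι E.jCore w with hΓ
  have hΓm : Γ ≫ m = E.sV ≫ Γfull := by
    apply pullback.hom_ext
    · rw [Category.assoc, Category.assoc, hm, pullback.lift_fst, ← Category.assoc, hΓ, pullback.lift_fst,
        hΓfull, pullback.lift_fst, E.sV_ψ, Category.comp_id]
    · rw [Category.assoc, Category.assoc, hm, pullback.lift_snd, ← Category.assoc, hΓ, pullback.lift_snd,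
        hΓfull, pullback.lift_snd, E.sV_ι, E.jCore_ι]
  -- and its range is the preimage of the closed range of `Γfull`
  suffices hrange : Set.range Γ = m ⁻¹' Set.range Γfull by
    rw [hrange]
    exact (Γfull.isClosedMap.isClosed_range).preimage m.continuous
  apply Set.Subset.antisymm
  · rintro _ ⟨x, rfl⟩
    refine ⟨E.sV x, ?_⟩
    show Γfull (E.sV x) = m (Γ x)
    rw [← Scheme.Hom.comp_apply, ← Scheme.Hom.comp_apply, hΓm]
  · rintro z ⟨v, hv⟩
    -- `v ∈ X°` (second coordinate) and `ψ v ∈ Uᵢ` (else `v ∈ Zᵢⱼ ⊆ Z̄ᵢⱼ`)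
    have h2 : E.V.ι v = E.core.ι (pullback.snd g (E.core.ι ≫ E.πX) z) := by
      have := congrArg (fun q => pullback.snd g E.πX q) hv
      simp only at this
      rw [← Scheme.Hom.comp_apply, hΓfull, pullback.lift_snd, ← Scheme.Hom.comp_apply, hm,
        pullback.lift_snd, Scheme.Hom.comp_apply] at this
      exact this
    have hvcore : E.V.ι v ∈ E.core := by rw [h2]; exact (pullback.snd g (E.core.ι ≫ E.πX) z).2
    have hψv : E.ψ v ∈ Ui := by
      by_contra hc
      exact hvcore (subset_closure ((E.mem_locus_iff _ v).mpr hc))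
    -- so `v = sV u` for `u = ψ v`
    have hveq := E.eq_sV_of_mem v hψv
    refine ⟨⟨E.ψ v, hψv⟩, m.injective ?_⟩
    rw [← Scheme.Hom.comp_apply, hΓm, Scheme.Hom.comp_apply, ← hveq, hv]

end ExtData

end Literature.AlgebraicGeometry.Morphisms

end
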